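import Summits.BirchSwinnertonDyer.BirchSwinnertonDyer.Theorems.KolyvaginRoadThreeMethod2OddSelmerRankOfPParity
import Summits.BirchSwinnertonDyer.BirchSwinnertonDyer.Theorems.KolyvaginRoadThreeMethod2OddSelmerRankOfLevelInputs
import Summits.BirchSwinnertonDyer.BirchSwinnertonDyer.Theorems.KolyvaginRoadThreeMethod2LevelPairingParity
import HarnessLib

/-!
# Route `KolyvaginRoadThree`, deciding crux `ZhangSharpFrameAtThreeHL` (item stmt-BirchSwinnertonDyer-19574):
# stub P `Method2.stub_oddSelmerRankAtThree` FROM THE 3-PARITY THEOREM OVER `ℚ` AND THE ROUTE'S OWN LEVELWISE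
# CASSELS–TATE BINDER hCT3 — no Gross–Zagier, no Kolyvagin, no finiteness of `Ш`, no all-levels Cassels–Tate fact
# (cell `bsd-stepL`, seat `bsd-stepL-zhang3-w1` g0; `--supports stmt-BirchSwinnertonDyer-19574`)

Third file of the seat on stub P of the METHOD skeleton v3.2 (`Cruxes/ZhangSharpFrameAtThreeHL/Lines/method2.lean`).
`KolyvaginRoadThreeMethod2OddSelmerRankOfPParity` (p682004) proved P's text VERBATIM from the Dokchitser–Dokchitser
`3`-parity theorem over `ℚ` (`selmerCorank_mod_two_eq · 3`) and the ALL-LEVELS Cassels–Tate fact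
`WeierstrassCurve.exists_casselsTate_pairing` over `K`. The route `KolyvaginRoadThree` does not carry that fact: its
`closes` binder hCT3 is the LEVELWISE input `Literature.NumberTheory.EllipticCurves.casselsTate_levelInputs K` (item
stmt-BirchSwinnertonDyer-20191; odd primes, base changes `E_K` of curves over `ℚ`), from which the all-levels fact
cannot be assembled (`exists_casselsTate_pairing_of_levelwise` needs every prime, `2` included). The sibling
`KolyvaginRoadThreeMethod2OddSelmerRankOfLevelInputs` (koly g16, p522478) runs on hCT3 only because Kolyvagin's theorem
makes `Ш(E/K)` FINITE there, so that one level pairing is non-degenerate on all of `Ш[3^∞]`.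

Here the finiteness is dispensed with: by the seat's algebra file `KolyvaginRoadThreeMethod2LevelPairingParity`
(`LevelParity.even_finrank_modN_primaryComponent_of_levelPairings`: level pairings at all powers of ONE prime on a
group with finite torsion levels ⇒ `dim_{𝔽_p} Ш[p^∞]/p` even, via the decomposition `Ш = Ш¹ ⊕ R` and ONE level
`p^{e+1}` killing `R_p`), the comparison `s = t + corank_{ℤ_p} Sel_{p^∞} + 2m` of the `p`-Selmer rank with the
`p^∞`-Selmer corank holds from LEVELWISE Cassels–Tate at `p` alone (`exists_selmerRank_eq_add_of_levelPairings`, the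
levelwise twin of the tree's `exists_selmerRank_eq_add`), for every elliptic curve over every number field, with NO
finiteness of `Ш`. Consequently:

* `odd_selmerRank_of_odd_selmerCorank_of_torsionBy_eq_bot_of_levelPairings` — corank odd + `E(F)[p] = 0` + level
  pairings at `p` ⇒ `#Sel_p(E/F) = p^s`, `s` odd;
* `stub_oddSelmerRankAtThree_of_pParity_of_casselsTateLevelInputs` — THE REGISTERED STUB P VERBATIM from
  `(∀ E/ℚ elliptic, selmerCorank_mod_two_eq E 3)` (Dokchitser–Dokchitser 2010 Thm. 1.4 at `p = 3`, analytic form) and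
  `(∀ K, casselsTate_levelInputs K)` = the route binder hCT3 VERBATIM (fed, as in p522478, with the complex conjugation
  of `K` and the Weil pairing via `exists_isLevelPairing_sha_baseChange_of_casselsTateLevelInputs`);
* `stub_oddSelmerRankAtThree_of_nekovar_of_casselsTateLevelInputs` — the same from Nekovář 2013 Thm. A +
  `hasEntireLFunction_rat` + hCT3.

So on the route's own terms P now costs EITHER {h₁ conjuncts 1, 2, 7 (GZ, Kolyvagin, modularity), hCT3} (p522478) OR
{DD `3`-parity over `ℚ`, hCT3} (this file): the Cassels–Tate input is the SAME existing binder in both, and the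
Gross–Zagier–Kolyvagin input is traded for the `3`-parity theorem over `ℚ`. P stays print-conditional AS TYPED. No case
of BSD is proved. PARTITION: O2@3 (B10) × A1 × crux 19574 × stub P — proves-glue; closes: none (T7).

References: [cite: DokchitserDokchitserAnnals2010, Thm. 1.4, Lemma 4.14] [cite: MilneADT2006, Ch. I §6, Thm. 6.13(a)]
[cite: Dokchitser2013ParityNotes, §2] [cite: Nekovar2013, Thm. A] [cite: WZhang2014, Thm. 9.2].
-/

noncomputable section

open scoped Classical AddSubgroup

namespace Summit.BirchSwinnertonDyer.Rank1Residual.X11b.Three.Koly.Method2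

open WeierstrassCurve NumberField Literature.NumberTheory.EllipticCurves
  Literature.NumberTheory.EllipticCurves.ModularForms
  Literature.NumberTheory.EllipticCurves.Rank1Residual Literature.Algebra.Module
  Summit.BirchSwinnertonDyer.Rank1Residual Summit.BirchSwinnertonDyer.Rank1Residual.X11b Module
open Literature.GroupTheory.FiniteAbelian (IsLevelPairing)

/-! ## The `p`-Selmer rank vs the `p^∞`-Selmer corank from LEVELWISE Cassels–Tate at `p` (any number field) -/

/-- **`s = t + corank_{ℤ_p} Sel_{p^∞}(E/F) + 2m` from level pairings at the powers of `p`** — the levelwise twin of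
the tree's `exists_selmerRank_eq_add` (which takes the all-levels fact `exists_casselsTate_pairing`). For an elliptic
curve `E` over a number field `F`, a prime `p`, `#Sel^(p)(E/F) = p^s`, `#E(F)[p] = p^t`, and for every `k ≥ 1` an
alternating pairing on `Ш(E/F)[p^k]` with left kernel `Ш[p^k] ∩ p^k Ш` (`IsLevelPairing`, Milne's fixed-level
Cassels–Tate theorem): `s = t + corank + 2m`. Proof = the tree's, with «`dim_{𝔽_p} Ш[p^∞]/p` even» now supplied by
`LevelParity.even_finrank_modN_primaryComponent_of_levelPairings` (all `Ш[n]` are finite: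
`finite_sha_torsionBy_holds`) — NO finiteness of `Ш`, no pairing at any other prime.
[cite: MilneADT2006, Ch. I §6, Thm. 6.13(a)] [cite: Dokchitser2013ParityNotes, §2 (first display and Definition)] -/
theorem exists_selmerRank_eq_add_of_levelPairings {F : Type} [Field F] [NumberField F] (E : WeierstrassCurve F)
    [E.IsElliptic] (p : ℕ) [hp : Fact p.Prime]
    (hlev : ∀ k : ℕ, 0 < k → ∃ B : (E.sha)[((p ^ k : ℕ) : ℤ)] →+ (E.sha)[((p ^ k : ℕ) : ℤ)] →+ AddCircle (1 : ℚ),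
      IsLevelPairing (p ^ k) B)
    (s t : ℕ) (hs : Nat.card (E.selmerGroup p) = p ^ s) (ht : Nat.card (E.toAffine.Point[(p : ℤ)]) = p ^ t) :
    ∃ m : ℕ, s = t + E.selmerCorank p + 2 * m := by
  have hp0 : p ≠ 0 := hp.out.ne_zero
  have hp0' : (p : ℤ) ≠ 0 := Int.natCast_ne_zero.mpr hp0
  -- `#Sel^(p) = p^r · #E[p] · #Ш[p]`
  have hSel := E.natCard_selmerGroup_eq hp0
  rw [hs, ht] at hSel
  -- `Ш[p] = Ш[p^∞][p]`, of order `p ^ u`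
  set T : AddSubgroup E.sha := AddCommGroup.primaryComponent E.sha p with hT
  haveI hShafin : Finite ((E.sha)[(p : ℤ)]) := E.finite_sha_torsionBy_holds (p : ℤ) hp0'
  have hcard1 : Nat.card (E.sha ⊓ AddSubgroup.torsionBy E.galH1 (p : ℤ) : AddSubgroup E.galH1) =
      Nat.card ((E.sha)[(p : ℤ)]) :=
    (natCard_torsionBy_addSubgroup E.sha (p : ℤ)).symm
  have hcard2 : Nat.card (T[(p : ℤ)]) = Nat.card ((E.sha)[(p : ℤ)]) :=
    natCard_torsionBy_primaryComponent
  letI : Module (ZMod p) (T[(p : ℤ)]) := AddSubgroup.torsionBy.zmodModule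
  haveI hTfin : Finite (T[(p : ℤ)]) :=
    Nat.finite_of_card_ne_zero (by rw [hcard2]; exact Nat.card_pos.ne')
  set u : ℕ := Module.finrank (ZMod p) (T[(p : ℤ)]) with hu
  have hpu : p ^ u = Nat.card (T[(p : ℤ)]) := pow_finrank_eq_natCard _
  -- `s = r + t + u`
  have hsum : s = E.mordellWeilRank + t + u := by
    apply Nat.pow_right_injective hp.out.two_le
    simp only [pow_add, hSel, hcard1, ← hcard2, ← hpu]
  -- LEVELWISE Cassels–Tate at `p`: `dim Ш[p^∞]/p = 2 v₂`
  have hfin : ∀ n : ℕ, 0 < n → ((E.sha)[(n : ℤ)] : Set E.sha).Finite := fun n hn ↦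
    @Set.toFinite _ _ (E.finite_sha_torsionBy_holds (n : ℤ) (Int.natCast_ne_zero.mpr hn.ne'))
  obtain ⟨hfinMod, v₂, hv⟩ := LevelParity.even_finrank_modN_primaryComponent_of_levelPairings (p := p) hfin hlev
  haveI := hfinMod
  -- `dim Ш[p^∞]/p ≤ dim Ш[p^∞][p] = u`
  have hTprim : ∀ c : T, ∃ n : ℕ, p ^ n • c = 0 := fun c ↦ by
    obtain ⟨n, hn⟩ := (AddCommGroup.mem_primaryComponent).mp c.2
    exact ⟨n, Subtype.ext (by rw [AddSubgroupClass.coe_nsmul, hn, ZeroMemClass.coe_zero])⟩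
  obtain ⟨-, hle⟩ := finite_modN_of_primary (C := T) (p := p) hTprim
  have hle' : Module.finrank (ZMod p) (ModN T p) ≤ u := by
    rw [← Nat.pow_le_pow_iff_right hp.out.one_lt, pow_finrank_eq_natCard, hpu]
    exact hle
  -- the corank identity
  have hcorank : E.selmerCorank p = E.mordellWeilRank + (u - Module.finrank (ZMod p) (ModN T p)) := by
    rw [E.selmerCorank_eq_mordellWeilRank_add_holds p]
    rfl
  refine ⟨v₂, ?_⟩
  rw [hcorank, hv] at *
  omega

/-- **Odd `p`-Selmer rank from an odd `p^∞`-Selmer corank, LEVELWISE.** For an elliptic curve `E` over a number field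
`F` and a prime `p` with `E(F)[p] = 0`, `corank_{ℤ_p} Sel_{p^∞}(E/F)` odd, and level pairings on `Ш(E/F)[p^k]` for all
`k ≥ 1`: `#Sel_p(E/F) = p^s` with `s` ODD. [cite: MilneADT2006, Ch. I §6, Thm. 6.13(a)]
[cite: Dokchitser2013ParityNotes, §2 (first display)] -/
theorem odd_selmerRank_of_odd_selmerCorank_of_torsionBy_eq_bot_of_levelPairings {F : Type} [Field F]
    [NumberField F] (E : WeierstrassCurve F) [E.IsElliptic] (p : ℕ) [Fact p.Prime]
    (hlev : ∀ k : ℕ, 0 < k → ∃ B : (E.sha)[((p ^ k : ℕ) : ℤ)] →+ (E.sha)[((p ^ k : ℕ) : ℤ)] →+ AddCircle (1 : ℚ),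
      IsLevelPairing (p ^ k) B)
    (hcorank : Odd (E.selmerCorank p))
    (htors : AddSubgroup.torsionBy E.toAffine.Point ((p : ℕ) : ℤ) = ⊥) :
    ∃ s : ℕ, Odd s ∧ Nat.card (E.selmerGroup ((p : ℕ) : ℤ)) = p ^ s := by
  obtain ⟨s, hs⟩ := exists_natCard_selmerGroup_eq_pow E p
  have ht : Nat.card (AddSubgroup.torsionBy E.toAffine.Point ((p : ℕ) : ℤ)) = p ^ 0 := by
    rw [htors, pow_zero, AddSubgroup.card_bot]
  obtain ⟨m, hm⟩ := exists_selmerRank_eq_add_of_levelPairings E p hlev s 0 hs ht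
  refine ⟨s, ?_, hs⟩
  rw [hm, zero_add, Nat.odd_add]
  exact iff_of_true hcorank (even_two_mul m)

/-! ## The stub from the `3`-parity theorem over `ℚ` and the ROUTE binder hCT3 -/

/-- **`Method2.stub_oddSelmerRankAtThree` (v3.2) FROM THE 3-PARITY THEOREM OVER `ℚ` AND THE ROUTE'S LEVELWISE
CASSELS–TATE BINDER — the registered signature VERBATIM.** At every Hoffstein–Luo A1 frame `dim_𝔽₃ Sel₃(E/K)` is odd:
`s₃(E/K) = s₃(E/ℚ) + s₃(E^{(d_K)}/ℚ)` is odd by Dokchitser–Dokchitser's `3`-parity theorem over `ℚ` (`r_an(E) = 1`,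
`r_an(E^{(d_K)}) = 0` unconditionally from `L(E^{(d_K)}, 1) ≠ 0`) and the proved quadratic decomposition
(`odd_selmerCorank_baseChange_of_selmerCorank_mod_two_eq`, p682004); `E(K)[3] = 0` (`Irr W 3`); and the levelwise
Cassels–Tate inputs `casselsTate_levelInputs K` — the decl of route support item stmt-BirchSwinnertonDyer-20191, i.e.
the binder hCT3 of the route's `closes` — give level pairings on `Ш(E_K)[3^k]` for all `k ≥ 1`
(`exists_isLevelPairing_sha_baseChange_of_casselsTateLevelInputs`, p522478), whence `dim_𝔽₃ Sel₃ ≡ s₃ (mod 2)` by the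
finiteness-free comparison `exists_selmerRank_eq_add_of_levelPairings`. CONDITIONAL on the two named inputs displayed
(both published); NO Gross–Zagier, NO Kolyvagin, NO modularity, NO Heegner hypothesis, NO finiteness of `Ш`.
[cite: DokchitserDokchitserAnnals2010, Thm. 1.4] [cite: MilneADT2006, Ch. I §6, Thm. 6.13(a)] [cite: WZhang2014, Thm. 9.2] -/
theorem stub_oddSelmerRankAtThree_of_pParity_of_casselsTateLevelInputs
    (hDD : ∀ (V : WeierstrassCurve ℚ) [V.IsElliptic], selmerCorank_mod_two_eq V 3)
    (hCT : ∀ (K : Type) [Field K] [NumberField K], casselsTate_levelInputs K) :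
    ∀ (W : WeierstrassCurve ℚ) [W.IsElliptic] [W.IsGloballyMinimal] [NeZero (W.conductorNorm ℤ)] (K : Type)
      [Field K] [NumberField K] (Dt : ModularParametrizationData W (W.conductorNorm ℤ)) (β : ℤ) (ι : K →+* ℂ),
      Summit.BirchSwinnertonDyer.Rank1Residual.ClassX11b W 3 → W.HasMultiplicativeReductionAtPrime 3 →
      Rank1Residual.Surj W 3 → Rank1Residual.Ram W 3 → ¬ 3 ∣ W.tamagawaProduct → IsImaginaryQuadratic K →
      Odd (NumberField.discr K) → SatisfiesHeegnerHypothesis (W.conductorNorm ℤ) K →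
      (W.quadraticTwist (NumberField.discr K : ℚ)).entireLFunction 1 ≠ 0 → NumberField.discr K ≠ -3 →
      (4 * (W.conductorNorm ℤ : ℤ)) ∣ β ^ 2 - NumberField.discr K → ¬ (3 : ℤ) ∣ Dt.c →
      ∀ [Module (ZMod 3) (V3 W K)],
      Odd (finrank (ZMod 3)
        (AddSubgroup.toZModSubmodule 3 (selmerGroup (W.baseChange K) ((3 ^ 1 : ℕ) : ℤ)))) := by
  intro W _ _ _ K _ _ Dt β ι hX _hmult _hsurj _hram _htam hK _hodd _hH hLt _h3 _hβ _hc _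
  haveI : Fact (Nat.Prime 3) := ⟨Nat.prime_three⟩
  haveI : (W.quadraticTwist (NumberField.discr K : ℚ)).IsElliptic :=
    W.isElliptic_quadraticTwist (Int.cast_ne_zero.mpr (NumberField.discr_ne_zero K))
  -- `r_an(E) = 1`, `r_an(E^{(d_K)}) = 0`, so `s₃(E/K)` is odd by DD over `ℚ` + the quadratic decomposition
  have hodd : Odd (W.analyticRank + (W.quadraticTwist (NumberField.discr K : ℚ)).analyticRank) := by
    rw [hX.1, analyticRank_eq_zero_of_entireLFunction_one_ne_zero _ hLt]
    exact odd_one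
  have hcorank : Odd ((W.baseChange K).selmerCorank 3) :=
    odd_selmerCorank_baseChange_of_selmerCorank_mod_two_eq W K hK.1 3 (hDD W)
      (hDD (W.quadraticTwist (NumberField.discr K : ℚ))) hodd
  -- `E(K)[3] = 0`; the levelwise Cassels–Tate inputs at `p = 3`
  have hbot := torsionBy_eq_bot_of_isImaginaryQuadratic_of_hasIrreducibleModPGaloisRep W K hK Nat.prime_three hX.2.2.2
  have hlev := fun k hk ↦ exists_isLevelPairing_sha_baseChange_of_casselsTateLevelInputs (hCT K) hK W k hk
  obtain ⟨s, hsodd, hs⟩ :=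
    odd_selmerRank_of_odd_selmerCorank_of_torsionBy_eq_bot_of_levelPairings (W.baseChange K) 3 hlev hcorank hbot
  rw [finrank_selmer_eq_of_natCard_eq_pow (W.baseChange K) hs]
  exact hsodd

/-- **`Method2.stub_oddSelmerRankAtThree` FROM NEKOVÁŘ 2013 THM. A AND THE ROUTE'S LEVELWISE CASSELS–TATE BINDER.**
Nekovář's `p`-parity theorem over the totally real field `ℚ` (`Nekovar2013_theoremA`) with the entire continuation of
`L(E/ℚ, s)` (`hasEntireLFunction_rat`) gives the `3`-parity theorem over `ℚ` (`selmerCorank_mod_two_eq_of_nekovar`);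
then `stub_oddSelmerRankAtThree_of_pParity_of_casselsTateLevelInputs`. CONDITIONAL on the three named inputs
displayed (all published). [cite: Nekovar2013, Thm. A] [cite: MilneADT2006, Ch. I §6, Thm. 6.13(a)] -/
theorem stub_oddSelmerRankAtThree_of_nekovar_of_casselsTateLevelInputs (hN : Nekovar2013_theoremA)
    (hL : hasEntireLFunction_rat) (hCT : ∀ (K : Type) [Field K] [NumberField K], casselsTate_levelInputs K) :
    ∀ (W : WeierstrassCurve ℚ) [W.IsElliptic] [W.IsGloballyMinimal] [NeZero (W.conductorNorm ℤ)] (K : Type)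
      [Field K] [NumberField K] (Dt : ModularParametrizationData W (W.conductorNorm ℤ)) (β : ℤ) (ι : K →+* ℂ),
      Summit.BirchSwinnertonDyer.Rank1Residual.ClassX11b W 3 → W.HasMultiplicativeReductionAtPrime 3 →
      Rank1Residual.Surj W 3 → Rank1Residual.Ram W 3 → ¬ 3 ∣ W.tamagawaProduct → IsImaginaryQuadratic K →
      Odd (NumberField.discr K) → SatisfiesHeegnerHypothesis (W.conductorNorm ℤ) K →
      (W.quadraticTwist (NumberField.discr K : ℚ)).entireLFunction 1 ≠ 0 → NumberField.discr K ≠ -3 →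
      (4 * (W.conductorNorm ℤ : ℤ)) ∣ β ^ 2 - NumberField.discr K → ¬ (3 : ℤ) ∣ Dt.c →
      ∀ [Module (ZMod 3) (V3 W K)],
      Odd (finrank (ZMod 3)
        (AddSubgroup.toZModSubmodule 3 (selmerGroup (W.baseChange K) ((3 ^ 1 : ℕ) : ℤ)))) :=
  haveI : Fact (Nat.Prime 3) := ⟨Nat.prime_three⟩
  stub_oddSelmerRankAtThree_of_pParity_of_casselsTateLevelInputs
    (fun V _ ↦ selmerCorank_mod_two_eq_of_nekovar hN hL V 3) hCT

end Summit.BirchSwinnertonDyer.Rank1Residual.X11b.Three.Koly.Method2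

end
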